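import Summits.BirchSwinnertonDyer.Rank1Residual.Partition.Rows
import Summits.BirchSwinnertonDyer.BirchSwinnertonDyer.Theorems.UpperNonSurjFive.Negative.TameInstrumentVacuous
import Literature.NumberTheory.EllipticCurves.PAdicHeights
import HarnessLib

/-!
# Typed statement — «TameInstrumentVacuous» (barrier memo BARRIER-tameMT-trivial-carriers-g29.md, §F3) — rev 2: NOW A THEOREM OF THE TREE

bsd-idea-6 g29 (statement) / g32 (rev 2, by-name citation), lens «decomp», crux-level only, W-79 publish-only.
rev 1 (957b16c5f049b40e) was a STATEMENT ONLY (`def TameInstrumentVacuous : Prop`).  rev 2 keeps the three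
`def`s VERBATIM and adds `theorem tameInstrumentVacuous_holds : TameInstrumentVacuous`, a one-line instantiation of
the referee's landed negative-lane theorem
`Theorems.UpperNonSurjFive.Negative.tameInstrumentVacuous_unfolded` (p754219, bsd-print-x11a REF g28, REF-AUDIT §ZD;
binders verbatim, `qInt`/`tateUnitResidue` unfolded; the referee's scratch PIN term), plus the SHARPER place-agnostic
form the landing proves (`tateUnitResidue_mem_range_powMonoidHom_of_irr_of_not_surj`: `Irr ∧ ¬Surj` only — no
`5 ≤ p`, no `ℓ ≠ p`, no `ℓ ≡ 1 (mod p)`, any Tate datum at any prime `ℓ`), which closes the door on every «other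
multiplicative layer» variant of the tame instrument.  No `sorry`; nothing registered; the line of record
`Lines/gl1cartan5.lean` rev 12 is untouched.  The tame companion of the landed negative lemma
`Theorems/UpperNonSurjFive/Negative/GSDepthInstrumentVacuous.lean`.  On U5 (`ClassX11a W p ∧ ¬ Surj W p ∧ 5 ≤ p`)
the image of `ρ̄_{E,p}` has order prime to `p`, so at a prime `ℓ ≠ p` of split multiplicative reduction with
`ℓ ≡ 1 (mod p)` the Frobenius at `ℓ` — a priori `(1 t; 0 1)` on the unramified Kummer extension
`0 → μ_p → E[p] → ℤ/p → 0` of class `q_ℓ` — must be trivial: the residue `ū_ℓ` of the unit part of the Tate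
period is a `p`-th power in `𝔽_ℓˣ`.  Consequently the tame Mazur–Tate identity
`λ_R(ū_ℓ)·[0] = ord_ℓ(q_ℓ)·θ'_{E,ℓ}` (MT87; de Shalit 1995; Lecouturier 2023 Conj. 1.1) has left side `≡ 0 (mod p)`
and cannot pay Tamagawa depth at `ℓ`.  Intended prover inputs: the image dichotomy used in
`ClassX11a.surj_of_not_dvd` (Serre 1972 §2.4 Prop. 15: a transvection + `Irr` ⇒ `Surj`), Tate's description of
`E[p]` over `ℚ_ℓ` (ATAEC V.6.1), Euler's criterion.  BSD is not proved by any of this; nothing here closes U5.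
-/

set_option autoImplicit false
set_option linter.dupNamespace false

noncomputable section

open WeierstrassCurve Literature.NumberTheory.EllipticCurves
  Literature.NumberTheory.EllipticCurves.Rank1Residual Summit.BirchSwinnertonDyer.Rank1Residual

namespace Summit.BirchSwinnertonDyer.BirchSwinnertonDyer.Cruxes.UpperNonSurjFive.TameMT

variable {W : WeierstrassCurve ℚ} [W.IsElliptic] {ℓ : ℕ} [Fact ℓ.Prime]

/-- The Tate parameter `q_ℓ ∈ ℚ_ℓ` as an `ℓ`-adic integer (`‖q_ℓ‖ < 1`). [folklore] -/
def qInt (D : TateParameterData W ℓ) : ℤ_[ℓ] := ⟨D.q, D.norm_q_lt_one.le⟩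

theorem qInt_ne_zero (D : TateParameterData W ℓ) : qInt D ≠ 0 := by
  intro h
  apply D.q_ne_zero
  have := congrArg (fun x : ℤ_[ℓ] => (x : ℚ_[ℓ])) h
  simpa [qInt] using this

/-- `ū_ℓ ∈ 𝔽_ℓˣ`: the residue of the unit part `u_ℓ = q_ℓ·ℓ^{-ord_ℓ q_ℓ}` of the Tate period
(Mathlib `PadicInt.unitCoeff`: `q = u·ℓ^{v(q)}`). [folklore] -/
def tateUnitResidue (D : TateParameterData W ℓ) : (ZMod ℓ)ˣ :=
  Units.map (PadicInt.toZMod (p := ℓ)).toMonoidHom (PadicInt.unitCoeff (qInt_ne_zero D))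

/-- **TameInstrumentVacuous** (barrier statement, §F3 of the memo): on U5, at every split multiplicative
`ℓ ≠ p` with `ℓ ≡ 1 (mod p)`, the Tate unit residue `ū_ℓ` is a `p`-th power in `𝔽_ℓˣ` — equivalently
`ρ̄_{E,p}(Frob_ℓ) = 1`, equivalently the tame regulator entry `λ_R(ū_ℓ)` of the Mazur–Tate leading term at
layer `ℓ` vanishes mod `p`.  (Split multiplicative reduction at `ℓ` is carried by the datum `D.split`.)
[cite: Serre1972, §2.4 Prop. 15] [cite: SilvermanATAEC1994, V.6 Prop. 6.1] -/
def TameInstrumentVacuous : Prop :=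
  ∀ (W : WeierstrassCurve ℚ) [W.IsElliptic] [W.IsGloballyMinimal] (p ℓ : ℕ) [Fact p.Prime] [Fact ℓ.Prime],
    ClassX11a W p → ¬ Surj W p → 5 ≤ p → ℓ ≠ p → ℓ % p = 1 →
      ∀ D : TateParameterData W ℓ, tateUnitResidue D ∈ (powMonoidHom p : (ZMod ℓ)ˣ →* (ZMod ℓ)ˣ).range

/-- **rev 2 — the barrier statement HOLDS**: `TameInstrumentVacuous` is a theorem of the tree's definitions, by a
one-line instantiation of the landed `Theorems.UpperNonSurjFive.Negative.tameInstrumentVacuous_unfolded` (p754219,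
REF g28) at `x := qInt D` (`↑(qInt D) = D.q` by `rfl`).  [cite: Serre1972, §2.4 Prop. 15]
[cite: SilvermanATAEC1994, V.6 Prop. 6.1] -/
theorem tameInstrumentVacuous_holds : TameInstrumentVacuous :=
  fun W _ _ p ℓ _ _ hX hns h5 hℓp hℓ1 D =>
    Theorems.UpperNonSurjFive.Negative.tameInstrumentVacuous_unfolded W p ℓ hX hns h5 hℓp hℓ1 D
      (qInt D) (qInt_ne_zero D) rfl

/-- **Sharper, place-agnostic form** (what the landing actually proves, REF-AUDIT §ZD §1–§3): for ANY `E/ℚ` and prime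
`p` with `E[p]` irreducible and `ρ̄_{E,p}` not surjective, at ANY prime `ℓ` carrying a Tate datum `D` (split
multiplicative reduction; `ℓ = p` allowed, no congruence on `ℓ`, no `5 ≤ p`), the Tate unit residue `ū_ℓ` is a `p`-th
power in `𝔽_ℓˣ`.  So no «other multiplicative layer `ℓ′`» rescues the tame Mazur–Tate instrument on `Irr ∧ ¬Surj`.
[cite: Serre1972, §2.4 Prop. 15] [cite: MochizukiGenEll2010, §3 Lemma 3.2 (i)] -/
theorem tateUnitResidue_mem_range_powMonoidHom_of_irr_of_not_surj (W : WeierstrassCurve ℚ) [W.IsElliptic]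
    (p : ℕ) [Fact p.Prime] (hirr : Irr W p) (hns : ¬ Surj W p) (ℓ : ℕ) [Fact ℓ.Prime]
    (D : TateParameterData W ℓ) :
    tateUnitResidue D ∈ (powMonoidHom p : (ZMod ℓ)ˣ →* (ZMod ℓ)ˣ).range :=
  Theorems.UpperNonSurjFive.Negative.unitCoeff_residue_mem_range_powMonoidHom_of_irr_of_not_surj W p hirr hns ℓ D
    (qInt_ne_zero D) rfl

/-- The U5-cell specialisation of the sharper form (`ClassX11a W p ∧ ¬ Surj W p`, any split multiplicative `ℓ`).
[cite: Serre1972, §2.4 Prop. 15] -/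
theorem tateUnitResidue_mem_range_powMonoidHom_of_classX11a_of_not_surj (W : WeierstrassCurve ℚ) [W.IsElliptic]
    [W.IsGloballyMinimal] (p : ℕ) [Fact p.Prime] (hX : ClassX11a W p) (hns : ¬ Surj W p) (ℓ : ℕ) [Fact ℓ.Prime]
    (D : TateParameterData W ℓ) :
    tateUnitResidue D ∈ (powMonoidHom p : (ZMod ℓ)ˣ →* (ZMod ℓ)ˣ).range :=
  Theorems.UpperNonSurjFive.Negative.unitCoeff_residue_mem_range_powMonoidHom_of_classX11a_of_not_surj W p hX hns ℓ
    D (qInt_ne_zero D) rfl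

end Summit.BirchSwinnertonDyer.BirchSwinnertonDyer.Cruxes.UpperNonSurjFive.TameMT

end
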